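import Summits.ResolutionOfSingularities.KangarooAtlas.MizutaniSpreadSupport
import Summits.ResolutionOfSingularities.KangarooAtlas.MizutaniCasesLayer
import HarnessLib

/-!
# Mizutani's conjecture `m(e) = 2p^e − 1` — the ABSTRACT PROFILE THEOREM `σ_i(ω) ≥ 2i + 1`

Cell topic `Summits/ResolutionOfSingularities/KangarooAtlas` (pub-rosobs); namespace
`Summit.ResolutionOfSingularities.KangarooAtlas.Mizutani`.  Part of the Lean transcription of the
in-house note MIZUTANI-PROOF-g59 (AI-written, AI-audited; *AI review is weaker than expert review*; not a
resolution theorem).  This file assembles encloser-1's ARCH-e1: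

**PROFILE THEOREM** (`profile_theorem`).  Let `k` be a field of characteristic `p`, `L ⊆ k` an infinite
subring, `s ≥ 2`, `q = p^e` (`e ≥ 1`), and `D : (Fin s →₀ ℕ) → (k →+ k)` additive operators with `D_0 = id`
commuting with `L` (`GoodOps`).  For every `f ∈ k[X_1..X_s]` supported in the box with all monomials of degree
`≥ q` and SOME genuine monomial (i.e. `f` models an element of `J^q ∖ I_S`, MIZUTANI-PROOF-g59 §1.2), the
profile satisfies `σ_r(f) = dim_k span{E_T f : |T| ≤ r} ≥ 2r + 1` for all `r ≤ q − 1`.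

This is the note's THEOREM E(s) (§7) — and, because the coefficient field `k` and the operator family `D` are
arbitrary, simultaneously its THEOREM Ê (§8) and the profile half of THEOREM F (§9): in a tower
`k' = 𝕜(x^{1/q}) ⊃ 𝕜` one takes `D` = the Hasse–Schmidt operators of the `p`-basis and `L = 𝕜` (the tower
envelope and Lemma 1.5, `rank ≥ σ_{q−1} + 1 ≥ 2q`, are separate files).  Proof: induction on `s`; spread to a
move-closed support (`exists_moveClosed_spread`, §5 Thm D″); for `s = 2` a genuine vertex
(`exists_genuine_vertex_two`, §6) + VERTEX BOUND (`card_vertexIndex_le_eProfile`, replacing Thm D/D‴) + DIGIT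
LEMMA (§4, `MizutaniDigitLemma_cumulative`, through Lucas); for `s ≥ 3` a good layer (`exists_good_layer`, §7
Cases A/B) + CLEAN LAYER LEMMA (`eProfile_layer_le`) + induction.

References: [Mizutani1973HironakaGroupSchemes] (Remark 2.10; in-house proof §§4–9);
[Oda1983HironakaGroupSchemeII] §1; [EGAIV4] Thm. 16.11.2.
-/

open MvPolynomial Literature.AlgebraicGeometry.Resolution

namespace Summit.ResolutionOfSingularities.KangarooAtlas.Mizutani

/-! ## The Digit Lemma feeds the vertex bound -/

section DigitBridge

variable {s : ℕ} {k : Type*} [Field k] {p e : ℕ} [hp : Fact p.Prime] [CharP k p]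

/-- **Digit Lemma ⇒ vertex count**: for a genuine `P` and `r + 1 ≤ q`,
`#{T ≤ P : |T| ≤ r, C(P,T) ≠ 0 in k} ≥ 2r + 1` (MIZUTANI-PROOF-g59 §4 through Lucas, §1.3 (F2)).
[cite: Mizutani1973HironakaGroupSchemes, Remark 2.10 (in-house proof §4 Digit Lemma, §1.4 MONOMIALS)] -/
theorem two_mul_add_one_le_card_vertexIndex {P : Fin s →₀ ℕ} (hP : IsGenuine p e P) {r : ℕ}
    (hr : r + 1 ≤ p ^ e) : 2 * r + 1 ≤ (vertexIndex k P r).card := by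
  classical
  have hp2 : 2 ≤ p := hp.out.two_le
  have hN : ∀ i, P i < p ^ e := hP.1
  have hW : p ^ e ≤ ∑ i, P i := by rw [← Finsupp.degree_eq_sum]; exact hP.2.1
  have hF : ∑ i, P i / p ≤ p ^ (e - 1) - 1 := by
    have := hP.2.2; rw [floorSum_eq_sum] at this; omega
  have hcount := MizutaniDigitLemma_cumulative p hp2 s e (⇑P) hN hW hF r (by omega)
  refine hcount.trans (Finset.card_le_card_of_injOn (fun T => Finsupp.equivFunOnFinite.symm T)
    (fun T hT => ?_) (fun T _ T' _ h => by simpa using h))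
  rw [Finset.mem_coe, Finset.mem_filter] at hT
  obtain ⟨-, hdig, hsum⟩ := hT
  rw [Finset.mem_coe, mem_vertexIndex]
  refine ⟨fun j => ?_, ?_, ?_⟩
  · rw [Finsupp.coe_equivFunOnFinite_symm]
    exact DigitLemma.le_of_digitLE hp2 (hdig j)
  · rw [Finsupp.degree_eq_sum]
    simpa [Finsupp.coe_equivFunOnFinite_symm] using hsum
  · rw [mchoose_eq_prod, Nat.cast_prod, Finset.prod_ne_zero_iff]
    intro j _
    rw [Finsupp.coe_equivFunOnFinite_symm, Ne, CharP.cast_eq_zero_iff k p]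
    exact (DigitLemma.digitLE_iff_not_dvd_choose _ _).mp (hdig j)

end DigitBridge

/-! ## The profile theorem -/

section Main

variable {k : Type*} [Field k] {p e : ℕ} [hp : Fact p.Prime] [CharP k p]

/-- `restrictD` preserves `GoodOps`. [folklore] -/
theorem GoodOps.restrictD {n : ℕ} {L : Subring k} {D : (Fin (n + 1) →₀ ℕ) → k →+ k} (hD : GoodOps L D)
    (c : Fin (n + 1)) : GoodOps L (restrictD c D) :=
  ⟨restrictD_zero c D hD.zero, fun x hx _ y => hD.mul x hx _ y⟩

omit hp [CharP k p] in
/-- The layer of an element whose `(c,h)`-layer is good is again admissible with a genuine monomial.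
[cite: Mizutani1973HironakaGroupSchemes, Remark 2.10 (in-house proof §7, (L1)/(L2) and the layer lemma)] -/
theorem layer_admissible {n : ℕ} (c : Fin (n + 1)) (h : ℕ) (f : MvPolynomial (Fin (n + 1)) k)
    (hadm : ∀ M ∈ f.support, InBox (p ^ e) M ∧ p ^ e ≤ M.degree)
    (hlayer : ∀ M ∈ f.support, M c = h → p ^ e ≤ (removeAt c M).degree)
    (hwit : ∃ M ∈ f.support, M c = h ∧ IsGenuine p e (removeAt c M)) :
    (∀ N ∈ (layer c h f).support, InBox (p ^ e) N ∧ p ^ e ≤ N.degree) ∧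
      ∃ N ∈ (layer c h f).support, IsGenuine p e N := by
  constructor
  · intro N hN
    rw [mem_support_layer] at hN
    have hM := hadm _ hN
    refine ⟨fun j => ?_, ?_⟩
    · have := hM.1 (c.succAbove j)
      rwa [insertAt_apply_succAbove] at this
    · have := hlayer _ hN (insertAt_apply_same c h N)
      rwa [removeAt_insertAt] at this
  · obtain ⟨M, hM, hMc, hgen⟩ := hwit
    refine ⟨removeAt c M, ?_, hgen⟩
    rw [mem_support_layer, ← hMc, insertAt_removeAt]
    exact hM

/-- **THE ABSTRACT PROFILE THEOREM** `σ_r(f) ≥ 2r + 1` (`r + 1 ≤ q`) for every genuine box-supported `f`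
over every field of characteristic `p` and every admissible operator family — MIZUTANI-PROOF-g59 THEOREM E(s)
(§7), and by the generality of `k` and `D` also the profile statement of THEOREMS Ê (§8) and F (§9), without
degeneration, completion or Cohen structure (encloser-1 ARCH-e1).
[cite: Mizutani1973HironakaGroupSchemes, Remark 2.10 (in-house proof §7 Theorem E(s), §9 Theorem F)] -/
theorem profile_theorem (L : Subring k) (hL : (L : Set k).Infinite) (he : 1 ≤ e) :
    ∀ s : ℕ, 2 ≤ s → ∀ (D : (Fin s →₀ ℕ) → k →+ k) (f : MvPolynomial (Fin s) k), GoodOps L D →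
      (∀ M ∈ f.support, InBox (p ^ e) M ∧ p ^ e ≤ M.degree) → (∃ M ∈ f.support, IsGenuine p e M) →
      ∀ r : ℕ, r + 1 ≤ p ^ e → 2 * r + 1 ≤ eProfile D r f := by
  intro s hs
  induction s, hs using Nat.le_induction with
  | base =>
    intro D f hD hadm hgen r hr
    -- spread to a move-closed support
    obtain ⟨D', f', hD', hadm', hclosed, hsub, hprof⟩ :=
      exists_moveClosed_spread (p := p) (e := e) L hL _ D f hD hadm le_add_self
    obtain ⟨G, hG, hGgen⟩ := hgen
    -- a genuine vertex, the vertex bound and the Digit Lemma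
    obtain ⟨P, hP, hPgen, hmin⟩ := exists_genuine_vertex_two he hclosed hadm' ⟨G, hsub hG, hGgen⟩
    have hq : 0 < p ^ e := pow_pos hp.out.pos e
    calc 2 * r + 1 ≤ (vertexIndex k P r).card := two_mul_add_one_le_card_vertexIndex hPgen hr
      _ ≤ eProfile D' r f' := card_vertexIndex_le_eProfile D' hD'.zero f' (lexWeight (p ^ e))
          (lexWeight_pos hq) P hP hmin r
      _ ≤ eProfile D r f := hprof r hr
  | succ n hn ih =>
    intro D f hD hadm hgen r hr
    obtain ⟨D', f', hD', hadm', hclosed, hsub, hprof⟩ :=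
      exists_moveClosed_spread (p := p) (e := e) L hL _ D f hD hadm le_add_self
    obtain ⟨G, hG, hGgen⟩ := hgen
    -- a good layer and the clean layer lemma
    obtain ⟨c, h, hlayer, hwit⟩ := exists_good_layer he hn hclosed hadm' ⟨G, hsub hG, hGgen⟩
    obtain ⟨hadm'', hgen''⟩ := layer_admissible c h f' hadm' hlayer hwit
    calc 2 * r + 1 ≤ eProfile (restrictD c D') r (layer c h f') :=
          ih (restrictD c D') (layer c h f') (hD'.restrictD c) hadm'' hgen'' r hr
      _ ≤ eProfile D' r f' := eProfile_layer_le c h D' r f'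
      _ ≤ eProfile D r f := hprof r hr

end Main

end Summit.ResolutionOfSingularities.KangarooAtlas.Mizutani
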